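import Summits.AtomisticToContinuum.BoseEinsteinCondensation.Theorems.BECThomsonPrincipleGDTransferSeededWitnessDefs
import Summits.AtomisticToContinuum.BoseEinsteinCondensation.Theorems.BECThomsonPrincipleGDTransferBareSecondVariationKinetic

/-!
# Route `BECThomsonPrinciple`, crux `GDTransfer` (stmt-AtomisticToContinuum-9482), line `seeded-continuity`:
# stub `stub_plainPairAlgebra`, part 2a — slot calculus of `B_n = Σ_i e_n(x_i)P_i`, `B_n† = Σ_i P_i^{(n)}` for the kinetic form

Support file of the registered stub `stub_plainPairAlgebra` (toolkit of `PlainKineticIdentity`, part 2b `…SeededPlainKinetic`).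
VERBATIM the landed slot calculus of the LNSS pair (`…BareSecondVariationKinetic`, `…Commutators`: `Λ_n† = B_n ∘ n̂₀^{-1/2}`,
`Λ_n = n̂₀^{-1/2} ∘ B_n†`) with the inverse root `n̂₀^{-1/2}` removed, for periodic `C¹` `f, g` and every `n ∈ ℤ³`:
* adjointness `∫ conj(f)·B_n g = ∫ conj(B_n† f)·g` on continuous functions (`integral_conj_mul_upB`);
* the slot piece `G_j = e_n(x_j)P_j g` is `C¹`, periodic, an eigenfunction of `∂_{j,a}` (`∂_{j,a}G_j = (2πi n_a/L)G_j`,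
  `P_j g` being flat in slot `j`), so one periodic integration by parts gives `∫ conj(∂_{j,a}f) G_j = −(2πi n_a/L)⟨f, G_j⟩`
  (`integral_conj_fderiv_mul_slot`), and the flat piece `P_j^{(n)} f` integrates to zero against `∂_{j,a}g`
  (`integral_conj_fourierAvg_mul_fderiv`);
* `∂_{j,a}(B_n g) = (2πi n_a/L)G_j + B_n(∂_{j,a}g)` and `∂_{j,a}(B_n† f) = B_n†(∂_{j,a}f) − (2πi n_a/L)P_j^{(n)}f`
  (`fderiv_upB_single`, `fderiv_dnB_single`);
* the two slot identities `∫ conj(∂_{j,a}f) ∂_{j,a}(B_n g) = −(2πi n_a/L)²⟨f, G_j⟩ + ⟨B_n†∂_{j,a}f, ∂_{j,a}g⟩`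
  (`tform_slot_upB`) and `∫ conj(∂_{j,a}(B_n† f)) ∂_{j,a}g = ⟨B_n†∂_{j,a}f, ∂_{j,a}g⟩` (`tform_slot_dnB`).
All [folklore] (KennedyLiebShastry1988 (12)–(14); arXiv:1211.2778 §2–3).
-/

noncomputable section

open MeasureTheory Filter
open scoped ENNReal NNReal ComplexConjugate

namespace Summit.AtomisticToContinuum.BoseEinsteinCondensation.Cruxes.GDTransfer.Seeded

namespace PlainKinetic

open Literature.MathematicalPhysics.QuantumManyBody.BoseGas
open Summit.AtomisticToContinuum.BoseEinsteinCondensation.Theorems.GaussianDominationCan.Negative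
open Summit.AtomisticToContinuum.BoseEinsteinCondensation.Cruxes.GDTransfer.DysonDressedWitness
open Lnss SecondVariation

variable {m : ℕ} {L : ℝ}

/-! ## Adjointness `⟨f, B_n g⟩ = ⟨B_n† f, g⟩` and the slot piece `G_j = e_n(x_j) P_j g` -/

/-- **`B_n` is the adjoint of `B_n†`** on continuous functions: `∫ conj(f)·B_n g = ∫ conj(B_n† f)·g`. [folklore] -/
theorem integral_conj_mul_upB (n : Fin 3 → ℤ) {f g : Config (m + 1) → ℂ} (hf : Continuous f)
    (hg : Continuous g) :
    ∫ X in cellN (m + 1) L, conj (f X) * (∑ i : Fin (m + 1), cellWave L n (X i) * cellAvg (m + 1) L i g X) =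
      ∫ X in cellN (m + 1) L, conj (∑ i : Fin (m + 1), fourierAvg m L n i f X) * g X := by
  -- adapted from `SecondVariation.integral_conj_mul_lnssUpper`
  have hint : ∀ i ∈ (Finset.univ : Finset (Fin (m + 1))), Integrable
      (fun X => conj (f X) * (cellWave L n (X i) * cellAvg (m + 1) L i g X))
      ((volume : Measure (Config (m + 1))).restrict (cellN (m + 1) L)) := fun i _ =>
    integrableOn_cellN ((Complex.continuous_conj.comp hf).mul
      (((continuous_cellWave L n).comp (continuous_apply i)).mul (continuous_cellAvg i hg))) L
  have hint' : ∀ i ∈ (Finset.univ : Finset (Fin (m + 1))), Integrable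
      (fun X => conj (fourierAvg m L n i f X) * g X)
      ((volume : Measure (Config (m + 1))).restrict (cellN (m + 1) L)) := fun i _ =>
    integrableOn_cellN ((Complex.continuous_conj.comp (continuous_fourierAvg n i hf)).mul hg) L
  calc ∫ X in cellN (m + 1) L, conj (f X) * (∑ i : Fin (m + 1), cellWave L n (X i) * cellAvg (m + 1) L i g X)
      = ∫ X in cellN (m + 1) L, ∑ i : Fin (m + 1), conj (f X) *
          (cellWave L n (X i) * cellAvg (m + 1) L i g X) := by
        refine integral_congr_ae (Eventually.of_forall fun X => ?_)
        simp only [Finset.mul_sum]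
    _ = ∑ i : Fin (m + 1), ∫ X in cellN (m + 1) L, conj (f X) *
          (cellWave L n (X i) * cellAvg (m + 1) L i g X) := integral_finsetSum _ hint
    _ = ∑ i : Fin (m + 1), ∫ X in cellN (m + 1) L, conj (fourierAvg m L n i f X) * g X :=
        Finset.sum_congr rfl fun i _ => integral_slot_eq_inner_fourierAvg n i hf hg
    _ = ∫ X in cellN (m + 1) L, ∑ i : Fin (m + 1), conj (fourierAvg m L n i f X) * g X :=
        (integral_finsetSum _ hint').symm
    _ = ∫ X in cellN (m + 1) L, conj (∑ i : Fin (m + 1), fourierAvg m L n i f X) * g X := by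
        refine integral_congr_ae (Eventually.of_forall fun X => ?_)
        simp only [map_sum, Finset.sum_mul]

/-- The slot piece `G_j = e_n(x_j) P_j g` of `B_n g` is `C¹` for `C¹` `g`. [folklore] -/
theorem contDiff_slot (n : Fin 3 → ℤ) (j : Fin (m + 1)) {g : Config (m + 1) → ℂ} (hg : ContDiff ℝ 1 g) :
    ContDiff ℝ 1 fun X : Config (m + 1) => cellWave L n (X j) * cellAvg (m + 1) L j g X :=
  (contDiff_cellWave_comp_apply (n := 1) L n j).mul (contDiff_cellAvg j hg)

/-- `G_j` is periodic for periodic `g` (`L ≠ 0`). [folklore] -/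
theorem slot_periodic (hL : L ≠ 0) (n : Fin 3 → ℤ) (j : Fin (m + 1)) {g : Config (m + 1) → ℂ}
    (hgp : ∀ (X : Config (m + 1)) (i : Fin (m + 1)) (k : Fin 3),
      g (X + Pi.single i (EuclideanSpace.single k L)) = g X)
    (X : Config (m + 1)) (i : Fin (m + 1)) (k : Fin 3) :
    cellWave L n ((X + Pi.single i (EuclideanSpace.single k L) : Config (m + 1)) j) *
        cellAvg (m + 1) L j g (X + Pi.single i (EuclideanSpace.single k L)) =
      cellWave L n (X j) * cellAvg (m + 1) L j g X := by
  rw [cellAvg_periodic j hgp X i k, Pi.add_apply]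
  rcases eq_or_ne i j with rfl | hij
  · rw [Pi.single_eq_same, cellWave_periodic hL]
  · rw [Pi.single_eq_of_ne' hij, add_zero]

/-- `G_j` is an eigenfunction of `∂_{j,a}`: `∂_{j,a} G_j = (2πi n_a/L) G_j` (`P_j g` is flat in slot `j`). [folklore] -/
theorem fderiv_slot_self (n : Fin 3 → ℤ) (j : Fin (m + 1)) (a : Fin 3) {g : Config (m + 1) → ℂ}
    (hg : ContDiff ℝ 1 g) (X : Config (m + 1)) :
    fderiv ℝ (fun Y : Config (m + 1) => cellWave L n (Y j) * cellAvg (m + 1) L j g Y) X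
        (Pi.single j (EuclideanSpace.single a 1)) =
      (2 * Real.pi * Complex.I * (n a) / L) * (cellWave L n (X j) * cellAvg (m + 1) L j g X) := by
  rw [fderiv_mul_apply (differentiable_cellWave_comp_apply L n j X)
      ((contDiff_cellAvg j hg).differentiable one_ne_zero X),
    fderiv_cellWave_comp_apply_single_single L n j j a X rfl, if_pos rfl, waveCoeff_eq,
    fderiv_cellAvg_single_self j hg X]
  ring

/-- **First integration by parts**: `∫ conj(∂_{j,a} f) G_j = −(2πi n_a/L) ∫ conj(f) G_j`. [folklore] -/
theorem integral_conj_fderiv_mul_slot (hL : 0 < L) (n : Fin 3 → ℤ) (j : Fin (m + 1)) (a : Fin 3)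
    {f g : Config (m + 1) → ℂ} (hf : ContDiff ℝ 1 f)
    (hfp : ∀ (X : Config (m + 1)) (i : Fin (m + 1)) (k : Fin 3),
      f (X + Pi.single i (EuclideanSpace.single k L)) = f X)
    (hg : ContDiff ℝ 1 g)
    (hgp : ∀ (X : Config (m + 1)) (i : Fin (m + 1)) (k : Fin 3),
      g (X + Pi.single i (EuclideanSpace.single k L)) = g X) :
    ∫ X in cellN (m + 1) L, conj (fderiv ℝ f X (Pi.single j (EuclideanSpace.single a 1))) *
        (cellWave L n (X j) * cellAvg (m + 1) L j g X) =
      -(2 * Real.pi * Complex.I * (n a) / L) *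
        ∫ X in cellN (m + 1) L, conj (f X) * (cellWave L n (X j) * cellAvg (m + 1) L j g X) := by
  -- adapted from `SecondVariation.integral_conj_fderiv_mul_slotUpper`
  have hGd := contDiff_slot (L := L) n j hg
  have hGp := slot_periodic hL.ne' n j hgp
  have hcf : ContDiff ℝ 1 fun X => conj (f X) := Complex.conjCLE.contDiff.comp hf
  have hcfp : ∀ (X : Config (m + 1)) (i : Fin (m + 1)) (k : Fin 3),
      conj (f (X + Pi.single i (EuclideanSpace.single k L))) = conj (f X) := fun X i k => by
    rw [hfp X i k]
  have hbp := integral_cellN_mul_fderiv_apply hL hGd hcf hGp hcfp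
    (Pi.single j (EuclideanSpace.single a 1))
  calc ∫ X in cellN (m + 1) L, conj (fderiv ℝ f X (Pi.single j (EuclideanSpace.single a 1))) *
        (cellWave L n (X j) * cellAvg (m + 1) L j g X)
      = ∫ X in cellN (m + 1) L, (cellWave L n (X j) * cellAvg (m + 1) L j g X) *
          fderiv ℝ (fun Y => conj (f Y)) X (Pi.single j (EuclideanSpace.single a 1)) := by
        refine integral_congr_ae (Eventually.of_forall fun X => ?_)
        simp only
        rw [fderiv_conj_apply (hf.differentiable one_ne_zero X), mul_comm]
    _ = -∫ X in cellN (m + 1) L, fderiv ℝ (fun Y : Config (m + 1) =>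
          cellWave L n (Y j) * cellAvg (m + 1) L j g Y) X
            (Pi.single j (EuclideanSpace.single a 1)) * conj (f X) := hbp
    _ = -∫ X in cellN (m + 1) L, (2 * Real.pi * Complex.I * (n a) / L) *
          (conj (f X) * (cellWave L n (X j) * cellAvg (m + 1) L j g X)) := by
        congr 1
        refine integral_congr_ae (Eventually.of_forall fun X => ?_)
        simp only
        rw [fderiv_slot_self n j a hg X]
        ring
    _ = -(2 * Real.pi * Complex.I * (n a) / L) *
        ∫ X in cellN (m + 1) L, conj (f X) * (cellWave L n (X j) * cellAvg (m + 1) L j g X) := by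
        rw [integral_const_mul, neg_mul]

/-- **Second integration by parts**: `∫ conj(P_j^{(n)} f) ∂_{j,a} g = 0` (`P_j^{(n)} f` is flat in slot `j`).
[folklore] -/
theorem integral_conj_fourierAvg_mul_fderiv (hL : 0 < L) (n : Fin 3 → ℤ) (j : Fin (m + 1)) (a : Fin 3)
    {f g : Config (m + 1) → ℂ} (hf : ContDiff ℝ 1 f)
    (hfp : ∀ (X : Config (m + 1)) (i : Fin (m + 1)) (k : Fin 3),
      f (X + Pi.single i (EuclideanSpace.single k L)) = f X)
    (hg : ContDiff ℝ 1 g)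
    (hgp : ∀ (X : Config (m + 1)) (i : Fin (m + 1)) (k : Fin 3),
      g (X + Pi.single i (EuclideanSpace.single k L)) = g X) :
    ∫ X in cellN (m + 1) L, conj (fourierAvg m L n j f X) *
        fderiv ℝ g X (Pi.single j (EuclideanSpace.single a 1)) = 0 := by
  -- adapted from `SecondVariation.integral_conj_rootInv_fourierAvg_mul_fderiv`
  have hFd : ContDiff ℝ 1 (fourierAvg m L n j f) := contDiff_fourierAvg n j hf
  have hFp := fourierAvg_periodic (L := L) n j hfp
  have hcF : ContDiff ℝ 1 fun X => conj (fourierAvg m L n j f X) := Complex.conjCLE.contDiff.comp hFd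
  have hcFp : ∀ (X : Config (m + 1)) (i : Fin (m + 1)) (k : Fin 3),
      conj (fourierAvg m L n j f (X + Pi.single i (EuclideanSpace.single k L))) =
        conj (fourierAvg m L n j f X) := fun X i k => by rw [hFp X i k]
  rw [integral_cellN_mul_fderiv_apply hL hcF hg hcFp hgp (Pi.single j (EuclideanSpace.single a 1))]
  have h0 : ∀ X, fderiv ℝ (fun Y => conj (fourierAvg m L n j f Y)) X
      (Pi.single j (EuclideanSpace.single a 1)) * g X = 0 := by
    intro X
    rw [fderiv_conj_apply (hFd.differentiable one_ne_zero X), fderiv_fourierAvg_single_self n j hf X _,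
      map_zero, zero_mul]
  simp_rw [h0]
  rw [integral_zero, neg_zero]

/-! ## `∂_{j,a}` through `B_n`, `B_n†` -/

/-- **Derivative of `B_n g`**: `∂_{j,a}(B_n g) = (2πi n_a/L) e_n(x_j) P_j g + B_n(∂_{j,a} g)` for periodic `C¹` `g`.
[folklore] -/
theorem fderiv_upB_single (hL : 0 < L) (n : Fin 3 → ℤ) (j : Fin (m + 1)) (a : Fin 3)
    {g : Config (m + 1) → ℂ} (hg : ContDiff ℝ 1 g)
    (hgp : ∀ (X : Config (m + 1)) (i : Fin (m + 1)) (k : Fin 3),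
      g (X + Pi.single i (EuclideanSpace.single k L)) = g X)
    (X : Config (m + 1)) :
    fderiv ℝ (fun Y : Config (m + 1) => ∑ i : Fin (m + 1), cellWave L n (Y i) * cellAvg (m + 1) L i g Y) X
        (Pi.single j (EuclideanSpace.single a 1)) =
      (2 * Real.pi * Complex.I * (n a) / L) * (cellWave L n (X j) * cellAvg (m + 1) L j g X) +
        ∑ i : Fin (m + 1), cellWave L n (X i) *
          cellAvg (m + 1) L i (fun Y => fderiv ℝ g Y (Pi.single j (EuclideanSpace.single a 1))) X := by
  -- adapted from `SecondVariation.fderiv_lnssUpper_single`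
  have hterm : ∀ i : Fin (m + 1),
      fderiv ℝ (fun Y => cellWave L n (Y i) * cellAvg (m + 1) L i g Y) X
          (Pi.single j (EuclideanSpace.single a 1)) =
        (if i = j then (2 * Real.pi * Complex.I * (n a) / L) * cellWave L n (X i) else 0) *
            cellAvg (m + 1) L i g X +
          cellWave L n (X i) *
            cellAvg (m + 1) L i (fun Y => fderiv ℝ g Y (Pi.single j (EuclideanSpace.single a 1))) X := by
    intro i
    rw [fderiv_mul_apply (differentiable_cellWave_comp_apply L n i X)
        ((contDiff_cellAvg i hg).differentiable one_ne_zero X),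
      fderiv_cellWave_comp_apply_single_single L n i j a X rfl, waveCoeff_eq,
      fderiv_cellAvg_single hL i j a hg hgp X]
  have hdiff : ∀ i ∈ (Finset.univ : Finset (Fin (m + 1))), DifferentiableAt ℝ
      (fun Y : Config (m + 1) => cellWave L n (Y i) * cellAvg (m + 1) L i g Y) X :=
    fun i _ => (differentiable_cellWave_comp_apply L n i X).mul
      ((contDiff_cellAvg i hg).differentiable one_ne_zero X)
  rw [fderiv_finset_sum_apply _ hdiff]
  simp only [hterm, Finset.sum_add_distrib, ite_mul, zero_mul, Finset.sum_ite_eq', Finset.mem_univ, if_true]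
  ring

/-- **Derivative of `B_n† f`**: `∂_{j,a}(B_n† f) = B_n†(∂_{j,a} f) − (2πi n_a/L) P_j^{(n)} f` for periodic `C¹` `f`
(`P_j^{(n)} f` is flat in slot `j`, and `P_j^{(n)} ∂_{j,a} = (2πi n_a/L) P_j^{(n)}`). [folklore] -/
theorem fderiv_dnB_single (hL : 0 < L) (n : Fin 3 → ℤ) (j : Fin (m + 1)) (a : Fin 3)
    {f : Config (m + 1) → ℂ} (hf : ContDiff ℝ 1 f)
    (hfp : ∀ (X : Config (m + 1)) (i : Fin (m + 1)) (k : Fin 3),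
      f (X + Pi.single i (EuclideanSpace.single k L)) = f X)
    (X : Config (m + 1)) :
    fderiv ℝ (fun Y => ∑ i : Fin (m + 1), fourierAvg m L n i f Y) X (Pi.single j (EuclideanSpace.single a 1)) =
      (∑ i : Fin (m + 1), fourierAvg m L n i
          (fun Z => fderiv ℝ f Z (Pi.single j (EuclideanSpace.single a 1))) X) -
        (2 * Real.pi * Complex.I * (n a) / L) * fourierAvg m L n j f X := by
  -- adapted from `SecondVariation.fderiv_lnssLower_single` (its step `hder`)
  rw [fderiv_finset_sum_apply _ (fun i _ => (contDiff_fourierAvg n i hf).differentiable one_ne_zero X)]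
  rw [← Finset.sum_erase_add _ _ (Finset.mem_univ j),
    ← Finset.sum_erase_add _ (fun i => fourierAvg m L n i
      (fun Z => fderiv ℝ f Z (Pi.single j (EuclideanSpace.single a 1))) X) (Finset.mem_univ j),
    fderiv_fourierAvg_single_self n j hf X, fourierAvg_fderiv_single_self hL n j hf hfp a X,
    Finset.sum_congr rfl fun i hi =>
      fderiv_fourierAvg_single_of_ne n (Finset.ne_of_mem_erase hi).symm hf X _]
  ring

/-! ## The slot identities -/

/-- **Slot `(j,a)` of `t(f, B_n g)`**:
`∫ conj(∂_{j,a}f) ∂_{j,a}(B_n g) = −(2πi n_a/L)² ∫ conj(f) G_j + ∫ conj(B_n† ∂_{j,a}f) ∂_{j,a}g`. [folklore] -/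
theorem tform_slot_upB (hL : 0 < L) (n : Fin 3 → ℤ) (j : Fin (m + 1)) (a : Fin 3)
    {f g : Config (m + 1) → ℂ} (hf : ContDiff ℝ 1 f)
    (hfp : ∀ (X : Config (m + 1)) (i : Fin (m + 1)) (k : Fin 3),
      f (X + Pi.single i (EuclideanSpace.single k L)) = f X)
    (hg : ContDiff ℝ 1 g)
    (hgp : ∀ (X : Config (m + 1)) (i : Fin (m + 1)) (k : Fin 3),
      g (X + Pi.single i (EuclideanSpace.single k L)) = g X) :
    ∫ X in cellN (m + 1) L, conj (fderiv ℝ f X (Pi.single j (EuclideanSpace.single a 1))) *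
        fderiv ℝ (fun Y : Config (m + 1) => ∑ i : Fin (m + 1), cellWave L n (Y i) * cellAvg (m + 1) L i g Y) X
          (Pi.single j (EuclideanSpace.single a 1)) =
      -(2 * Real.pi * Complex.I * (n a) / L) ^ 2 *
          (∫ X in cellN (m + 1) L, conj (f X) * (cellWave L n (X j) * cellAvg (m + 1) L j g X)) +
        ∫ X in cellN (m + 1) L,
          conj (∑ i : Fin (m + 1), fourierAvg m L n i
            (fun Y => fderiv ℝ f Y (Pi.single j (EuclideanSpace.single a 1))) X) *
            fderiv ℝ g X (Pi.single j (EuclideanSpace.single a 1)) := by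
  -- adapted from `SecondVariation.tform_slot_lnssUpper`
  have hf' : Continuous fun Y => fderiv ℝ f Y (Pi.single j (EuclideanSpace.single a 1)) :=
    continuous_fderiv_apply_const hf _
  have hg' : Continuous fun Y => fderiv ℝ g Y (Pi.single j (EuclideanSpace.single a 1)) :=
    continuous_fderiv_apply_const hg _
  have hcf' : Continuous fun Y => conj (fderiv ℝ f Y (Pi.single j (EuclideanSpace.single a 1))) :=
    Complex.continuous_conj.comp hf'
  have hGc : Continuous fun X : Config (m + 1) => cellWave L n (X j) * cellAvg (m + 1) L j g X :=
    (contDiff_slot n j hg).continuous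
  have hUc : Continuous fun X : Config (m + 1) => ∑ i : Fin (m + 1), cellWave L n (X i) *
      cellAvg (m + 1) L i (fun Y => fderiv ℝ g Y (Pi.single j (EuclideanSpace.single a 1))) X :=
    continuous_finsetSum _ fun i _ =>
      ((continuous_cellWave L n).comp (continuous_apply i)).mul (continuous_cellAvg i hg')
  have h1 : IntegrableOn (fun X => (2 * Real.pi * Complex.I * (n a) / L) *
      (conj (fderiv ℝ f X (Pi.single j (EuclideanSpace.single a 1))) *
        (cellWave L n (X j) * cellAvg (m + 1) L j g X))) (cellN (m + 1) L) volume :=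
    integrableOn_cellN (continuous_const.mul (hcf'.mul hGc)) L
  have h2 : IntegrableOn (fun X => conj (fderiv ℝ f X (Pi.single j (EuclideanSpace.single a 1))) *
      ∑ i : Fin (m + 1), cellWave L n (X i) *
        cellAvg (m + 1) L i (fun Y => fderiv ℝ g Y (Pi.single j (EuclideanSpace.single a 1))) X)
      (cellN (m + 1) L) volume := integrableOn_cellN (hcf'.mul hUc) L
  calc ∫ X in cellN (m + 1) L, conj (fderiv ℝ f X (Pi.single j (EuclideanSpace.single a 1))) *
        fderiv ℝ (fun Y : Config (m + 1) => ∑ i : Fin (m + 1), cellWave L n (Y i) * cellAvg (m + 1) L i g Y) X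
          (Pi.single j (EuclideanSpace.single a 1))
      = ∫ X in cellN (m + 1) L, (2 * Real.pi * Complex.I * (n a) / L) *
          (conj (fderiv ℝ f X (Pi.single j (EuclideanSpace.single a 1))) *
            (cellWave L n (X j) * cellAvg (m + 1) L j g X)) +
          conj (fderiv ℝ f X (Pi.single j (EuclideanSpace.single a 1))) *
            ∑ i : Fin (m + 1), cellWave L n (X i) *
              cellAvg (m + 1) L i (fun Y => fderiv ℝ g Y (Pi.single j (EuclideanSpace.single a 1))) X := by
        refine integral_congr_ae (Eventually.of_forall fun X => ?_)
        simp only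
        rw [fderiv_upB_single hL n j a hg hgp X]
        ring
    _ = (2 * Real.pi * Complex.I * (n a) / L) *
          (∫ X in cellN (m + 1) L, conj (fderiv ℝ f X (Pi.single j (EuclideanSpace.single a 1))) *
            (cellWave L n (X j) * cellAvg (m + 1) L j g X)) +
          ∫ X in cellN (m + 1) L, conj (fderiv ℝ f X (Pi.single j (EuclideanSpace.single a 1))) *
            ∑ i : Fin (m + 1), cellWave L n (X i) *
              cellAvg (m + 1) L i (fun Y => fderiv ℝ g Y (Pi.single j (EuclideanSpace.single a 1))) X := by
        rw [integral_add h1 h2, integral_const_mul]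
    _ = _ := by
        rw [integral_conj_fderiv_mul_slot hL n j a hf hfp hg hgp, integral_conj_mul_upB n hf' hg']
        ring

/-- **Slot `(j,a)` of `t(B_n† f, g)`**: `∫ conj(∂_{j,a}(B_n† f)) ∂_{j,a}g = ∫ conj(B_n† ∂_{j,a}f) ∂_{j,a}g` (the flat piece
integrates to zero against `∂_{j,a} g`). [folklore] -/
theorem tform_slot_dnB (hL : 0 < L) (n : Fin 3 → ℤ) (j : Fin (m + 1)) (a : Fin 3)
    {f g : Config (m + 1) → ℂ} (hf : ContDiff ℝ 1 f)
    (hfp : ∀ (X : Config (m + 1)) (i : Fin (m + 1)) (k : Fin 3),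
      f (X + Pi.single i (EuclideanSpace.single k L)) = f X)
    (hg : ContDiff ℝ 1 g)
    (hgp : ∀ (X : Config (m + 1)) (i : Fin (m + 1)) (k : Fin 3),
      g (X + Pi.single i (EuclideanSpace.single k L)) = g X) :
    ∫ X in cellN (m + 1) L,
        conj (fderiv ℝ (fun Y => ∑ i : Fin (m + 1), fourierAvg m L n i f Y) X
          (Pi.single j (EuclideanSpace.single a 1))) *
          fderiv ℝ g X (Pi.single j (EuclideanSpace.single a 1)) =
      ∫ X in cellN (m + 1) L,
        conj (∑ i : Fin (m + 1), fourierAvg m L n i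
          (fun Y => fderiv ℝ f Y (Pi.single j (EuclideanSpace.single a 1))) X) *
          fderiv ℝ g X (Pi.single j (EuclideanSpace.single a 1)) := by
  -- adapted from `SecondVariation.tform_slot_lnssLower`
  have hf' : Continuous fun Y => fderiv ℝ f Y (Pi.single j (EuclideanSpace.single a 1)) :=
    continuous_fderiv_apply_const hf _
  have hg' : Continuous fun Y => fderiv ℝ g Y (Pi.single j (EuclideanSpace.single a 1)) :=
    continuous_fderiv_apply_const hg _
  have hLc : Continuous fun X => ∑ i : Fin (m + 1), fourierAvg m L n i
      (fun Y => fderiv ℝ f Y (Pi.single j (EuclideanSpace.single a 1))) X :=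
    continuous_sum_fourierAvg n hf'
  have hRc : Continuous (fourierAvg m L n j f) := continuous_fourierAvg n j hf.continuous
  have h1 : IntegrableOn (fun X =>
      conj (∑ i : Fin (m + 1), fourierAvg m L n i
        (fun Y => fderiv ℝ f Y (Pi.single j (EuclideanSpace.single a 1))) X) *
        fderiv ℝ g X (Pi.single j (EuclideanSpace.single a 1))) (cellN (m + 1) L) volume :=
    integrableOn_cellN ((Complex.continuous_conj.comp hLc).mul hg') L
  have h2 : IntegrableOn (fun X => conj (2 * Real.pi * Complex.I * (n a) / L) *
      (conj (fourierAvg m L n j f X) * fderiv ℝ g X (Pi.single j (EuclideanSpace.single a 1))))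
      (cellN (m + 1) L) volume :=
    integrableOn_cellN (continuous_const.mul ((Complex.continuous_conj.comp hRc).mul hg')) L
  calc ∫ X in cellN (m + 1) L,
        conj (fderiv ℝ (fun Y => ∑ i : Fin (m + 1), fourierAvg m L n i f Y) X
          (Pi.single j (EuclideanSpace.single a 1))) *
          fderiv ℝ g X (Pi.single j (EuclideanSpace.single a 1))
      = ∫ X in cellN (m + 1) L,
          conj (∑ i : Fin (m + 1), fourierAvg m L n i
            (fun Y => fderiv ℝ f Y (Pi.single j (EuclideanSpace.single a 1))) X) *
              fderiv ℝ g X (Pi.single j (EuclideanSpace.single a 1)) -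
            conj (2 * Real.pi * Complex.I * (n a) / L) *
              (conj (fourierAvg m L n j f X) * fderiv ℝ g X (Pi.single j (EuclideanSpace.single a 1))) := by
        refine integral_congr_ae (Eventually.of_forall fun X => ?_)
        simp only
        rw [fderiv_dnB_single hL n j a hf hfp X, map_sub, map_mul]
        ring
    _ = _ := by
        rw [integral_sub h1 h2, integral_const_mul, integral_conj_fourierAvg_mul_fderiv hL n j a hf hfp hg hgp,
          mul_zero, sub_zero]

end PlainKinetic

/-- **Part 2a of `stub_plainPairAlgebra` (registered helper statement)**: slot `(j,a)` of the kinetic form against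
`B_n g = Σ_i e_n(x_i)P_i g` — `∫ conj(∂_{j,a}f) ∂_{j,a}(B_n g) = −(2πi n_a/L)² ∫ conj(f) e_n(x_j)P_j g + ∫ conj(B_n†∂_{j,a}f) ∂_{j,a}g`
for periodic `C¹` `f, g` (`L > 0`). [folklore] -/
theorem plainKinetic_tform_slot_upB :
    ∀ (m : ℕ) (L : ℝ), 0 < L → ∀ (n : Fin 3 → ℤ) (j : Fin (m + 1)) (a : Fin 3)
      (f g : Literature.MathematicalPhysics.QuantumManyBody.BoseGas.Config (m + 1) → ℂ),
      ContDiff ℝ 1 f →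
      (∀ (X : Literature.MathematicalPhysics.QuantumManyBody.BoseGas.Config (m + 1)) (i : Fin (m + 1)) (k : Fin 3),
          f (X + Pi.single i (EuclideanSpace.single k L)) = f X) →
      ContDiff ℝ 1 g →
      (∀ (X : Literature.MathematicalPhysics.QuantumManyBody.BoseGas.Config (m + 1)) (i : Fin (m + 1)) (k : Fin 3),
          g (X + Pi.single i (EuclideanSpace.single k L)) = g X) →
        ∫ X in Literature.MathematicalPhysics.QuantumManyBody.BoseGas.cellN (m + 1) L,
            conj (fderiv ℝ f X (Pi.single j (EuclideanSpace.single a (1 : ℝ)))) *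
              fderiv ℝ (fun Y : Literature.MathematicalPhysics.QuantumManyBody.BoseGas.Config (m + 1) =>
                ∑ i : Fin (m + 1), Literature.MathematicalPhysics.QuantumManyBody.BoseGas.cellWave L n (Y i) *
                  Summit.AtomisticToContinuum.BoseEinsteinCondensation.Theorems.GaussianDominationCan.Negative.cellAvg
                    (m + 1) L i g Y) X (Pi.single j (EuclideanSpace.single a (1 : ℝ))) =
          -(2 * Real.pi * Complex.I * (n a) / L) ^ 2 *
              (∫ X in Literature.MathematicalPhysics.QuantumManyBody.BoseGas.cellN (m + 1) L, conj (f X) *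
                (Literature.MathematicalPhysics.QuantumManyBody.BoseGas.cellWave L n (X j) *
                  Summit.AtomisticToContinuum.BoseEinsteinCondensation.Theorems.GaussianDominationCan.Negative.cellAvg
                    (m + 1) L j g X)) +
            ∫ X in Literature.MathematicalPhysics.QuantumManyBody.BoseGas.cellN (m + 1) L,
              conj (∑ i : Fin (m + 1),
                Summit.AtomisticToContinuum.BoseEinsteinCondensation.Cruxes.GDTransfer.DysonDressedWitness.fourierAvg m L n i
                  (fun Y => fderiv ℝ f Y (Pi.single j (EuclideanSpace.single a (1 : ℝ)))) X) *
                fderiv ℝ g X (Pi.single j (EuclideanSpace.single a (1 : ℝ))) :=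
  fun _ _ hL n j a _ _ hf hfp hg hgp => PlainKinetic.tform_slot_upB hL n j a hf hfp hg hgp

end Summit.AtomisticToContinuum.BoseEinsteinCondensation.Cruxes.GDTransfer.Seeded

end
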